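import Summits.AtomisticToContinuum.FouriersLaw.Theorems.ParityLiouvilleSeedLiouvilleForHeatHarmonicGibbsDefs
import Literature.MathematicalPhysics.KineticTheory.InfiniteChainGibbsStationarityPinned
import Literature.MathematicalPhysics.KineticTheory.InfiniteChainGibbsPositionByParts
import Literature.MathematicalPhysics.KineticTheory.InfiniteChainWindowKernel
import Literature.MathematicalPhysics.KineticTheory.InfiniteChainGibbsNormalisable

/-!
# Finite-volume Gibbs distributions of the harmonic chain on a box

Helper file for the REGULARITY part of the harmonic tightness witness of
`ParityLiouvilleSeed.LiouvilleForHeat` (`stmt-AtomisticToContinuum-13980`); objects in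
`ParityLiouvilleSeedLiouvilleForHeatHarmonicGibbsDefs` (`boxEquiv`, `insBox`, `boxQuad`).

For the harmonic pinned chain `P = pinnedChain ω₂ 0 0 γ` at temperature `T = 1` and a box
`Λ = {a, …, a+n}`:

* `lmarginal_Icc_eq_lintegral_insBox` — marginal integrals over `Λ` are Lebesgue integrals over box
  data `x : Fin (n+1) → ℝ × ℝ` inserted into the boundary condition (`insBox`);
* `hamiltonianIn_insBox_le` — `H_Λ(x | η) ≤ ∑ᵢ (pᵢ²/2 + (ω₂/2 + 2) qᵢ²) + q_{a-1}(η)² + q_{a+n+1}(η)²`;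
* `boxZ_le_pow` — the normaliser `Z_Λ(η) ≤ z₀^{n+1}`, `boxZ_pos`, `boxZ_lt_top`;
* `integral_chainSpecification_exp_comp_box` — `γ_Λ(· | η)` integrates `e^{ψ ∘ box}` to
  `(∫⁻ e^{ψ(x)} e^{-H_Λ(x|η)} dx / Z_Λ(η)).toReal`;
* `integral_eq_integral_chainSpecification_pinnedChain` — the DLR equation for bounded observables;
* `exists_gibbs_boundary_control` — a shift-invariant Gibbs state `μ` of `P` at `T = 1` and a radius
  `R` with `μ{|q_{x}| ≤ R ∧ |q_{y}| ≤ R} ≥ 1/2` for all sites `x, y` (Chebyshev on second moments).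
-/

noncomputable section

open MeasureTheory ProbabilityTheory Filter Set Function
open scoped NNReal ENNReal
open Literature.MathematicalPhysics.KineticTheory.HeatConduction Literature.Probability.LatticeModels

namespace Summit.AtomisticToContinuum.FouriersLaw.Theorems.ParityLiouvilleSeed.HarmonicWitness

variable (ω₂ : ℝ) (a : ℤ) (n : ℕ)

/-! ### Marginal integrals over a box as Lebesgue integrals over box data -/

/-- Sums over the box re-indexed by `Fin (n+1)`. [folklore] -/
theorem sum_Icc_eq_sum_fin (f : ℤ → ℝ) : ∑ z ∈ Finset.Icc a (a + n), f z = ∑ i : Fin (n + 1), f (a + i) := by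
  rw [← Finset.sum_coe_sort, ← (boxEquiv a n).sum_comp]
  rfl

/-- The box `{a, …, a+n}` has `n + 1` sites. [folklore] -/
theorem card_Icc_box : (Finset.Icc a (a + n)).card = n + 1 := by
  rw [Int.card_Icc]; omega

/-- The insertion is the `updateFinset` of the re-indexed data. [folklore] -/
theorem insBox_eq_updateFinset (η : ChainConfig) (x : Fin (n + 1) → ℝ × ℝ) :
    insBox a n η x = Function.updateFinset η (Finset.Icc a (a + n))
      ((MeasurableEquiv.piCongrLeft (fun _ : Fin (n + 1) => ℝ × ℝ) (boxEquiv a n).symm).symm x) := by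
  unfold insBox
  congr 1

/-- **Marginal integrals over the box are Lebesgue integrals over inserted box data.** [folklore] -/
theorem lmarginal_Icc_eq_lintegral_insBox (F : ChainConfig → ℝ≥0∞) (η : ChainConfig) :
    (∫⋯∫⁻_Finset.Icc a (a + n), F ∂fun _ : ℤ => (volume : Measure (ℝ × ℝ))) η =
      ∫⁻ x : Fin (n + 1) → ℝ × ℝ, F (insBox a n η x) := by
  set e := (MeasurableEquiv.piCongrLeft (fun _ : Fin (n + 1) => ℝ × ℝ) (boxEquiv a n).symm).symm with he
  have hmp : MeasurePreserving e volume volume :=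
    (volume_measurePreserving_piCongrLeft (fun _ : Fin (n + 1) => ℝ × ℝ) (boxEquiv a n).symm).symm _
  unfold lmarginal
  rw [show (Measure.pi fun i : ↥(Finset.Icc a (a + n)) => (fun _ : ℤ => (volume : Measure (ℝ × ℝ))) i) =
      (volume : Measure (↥(Finset.Icc a (a + n)) → ℝ × ℝ)) from rfl,
    hmp.lintegral_map_equiv]
  refine lintegral_congr fun x => ?_
  rw [insBox_eq_updateFinset]

/-! ### The harmonic box energy with boundary condition -/

/-- The on-site potential of the harmonic chain. [folklore] -/
theorem pinnedChain_U_harmonic (γ q : ℝ) : (pinnedChain ω₂ 0 0 γ).U q = ω₂ * q ^ 2 / 2 := by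
  show ω₂ * q ^ 2 / 2 + 0 * q ^ 4 / 4 = _; ring

/-- The interaction potential of the harmonic chain. [folklore] -/
theorem pinnedChain_V_harmonic (γ r : ℝ) : (pinnedChain ω₂ 0 0 γ).V r = r ^ 2 / 2 := by
  show r ^ 2 / 2 + 0 * r ^ 4 / 4 = _; ring

/-- **The box energy is dominated by a diagonal quadratic plus the boundary**:
`H_Λ(x | η) ≤ ∑ᵢ (pᵢ²/2 + (ω₂/2 + 2) qᵢ²) + q_{a-1}(η)² + q_{a+n+1}(η)²` (any real `ω₂`; bound each
bond `(q' - q)²/2 ≤ q'² + q²`). [folklore] -/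
theorem hamiltonianIn_insBox_le (γ : ℝ) (η : ChainConfig) (x : Fin (n + 1) → ℝ × ℝ) :
    hamiltonianIn (pinnedChain ω₂ 0 0 γ).chainPotential OscillatorChain.chainSupp (Finset.Icc a (a + n))
        (insBox a n η x) ≤
      boxQuad (ω₂ / 2 + 2) x + ((η (a - 1)).1 ^ 2 + (η (a + n + 1)).1 ^ 2) := by
  rw [OscillatorChain.hamiltonianIn_chain, OscillatorChain.bondSet_Icc (by omega : a ≤ a + n)]
  simp only [pinnedChain_U_harmonic, pinnedChain_V_harmonic]
  -- site terms
  rw [sum_Icc_eq_sum_fin a n]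
  simp only [insBox_apply_box]
  -- bond terms, indexed by `j : Fin (n + 2)` via `y = (a - 1) + j`
  have hb := sum_Icc_eq_sum_fin (a - 1) (n + 1)
    (fun y => ((insBox a n η x (y + 1)).1 - (insBox a n η x y).1) ^ 2 / 2)
  rw [show a - 1 + ((n + 1 : ℕ) : ℤ) = a + n by push_cast; ring] at hb
  rw [hb]
  -- the values `q_{a-1+j}`, `j = 0, …, n+2`
  set Q : ℕ → ℝ := fun j => (insBox a n η x (a - 1 + j)).1 with hQ
  have hQ0 : Q 0 = (η (a - 1)).1 := by
    simp only [hQ, Nat.cast_zero, add_zero]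
    rw [insBox_apply_of_not_mem]
    simp only [Finset.mem_Icc]; omega
  have hQlast : Q (n + 2) = (η (a + n + 1)).1 := by
    simp only [hQ]
    rw [insBox_apply_of_not_mem a n η x _ (by simp only [Finset.mem_Icc]; omega)]
    congr 2; push_cast; ring
  have hQmid : ∀ i : Fin (n + 1), Q (i + 1) = (x i).1 := by
    intro i
    simp only [hQ]
    rw [show a - 1 + ((((i : ℕ) + 1 : ℕ)) : ℤ) = a + (i : ℤ) by push_cast; ring, insBox_apply_box]
  have hbond : ∀ j : Fin (n + 2),
      ((insBox a n η x (a - 1 + (j : ℤ) + 1)).1 - (insBox a n η x (a - 1 + (j : ℤ))).1) ^ 2 / 2 ≤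
        Q (j + 1) ^ 2 + Q j ^ 2 := by
    intro j
    have e1 : (insBox a n η x (a - 1 + (j : ℤ) + 1)).1 = Q (j + 1) := by
      simp only [hQ]; congr 2; push_cast; ring
    have e2 : (insBox a n η x (a - 1 + (j : ℤ))).1 = Q j := rfl
    rw [e1, e2]
    nlinarith [sq_nonneg (Q (j + 1) + Q j)]
  have hsum : ∑ j : Fin (n + 2), (Q (j + 1) ^ 2 + Q j ^ 2) =
      2 * ∑ i : Fin (n + 1), (x i).1 ^ 2 + ((η (a - 1)).1 ^ 2 + (η (a + n + 1)).1 ^ 2) := by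
    rw [Finset.sum_add_distrib, Fin.sum_univ_castSucc (fun j : Fin (n + 2) => Q (j + 1) ^ 2),
      Fin.sum_univ_succ (fun j : Fin (n + 2) => Q j ^ 2)]
    simp only [Fin.val_castSucc, Fin.val_last, Fin.val_zero, Fin.val_succ, hQ0, hQlast, hQmid]
    ring
  calc ∑ i : Fin (n + 1), ((x i).2 ^ 2 / 2 + ω₂ * (x i).1 ^ 2 / 2) +
        ∑ j : Fin (n + 2), ((insBox a n η x (a - 1 + (j : ℤ) + 1)).1 - (insBox a n η x (a - 1 + (j : ℤ))).1) ^ 2 / 2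
      ≤ ∑ i : Fin (n + 1), ((x i).2 ^ 2 / 2 + ω₂ * (x i).1 ^ 2 / 2) + ∑ j : Fin (n + 2), (Q (j + 1) ^ 2 + Q j ^ 2) :=
        add_le_add le_rfl (Finset.sum_le_sum fun j _ => hbond j)
    _ = boxQuad (ω₂ / 2 + 2) x + ((η (a - 1)).1 ^ 2 + (η (a + n + 1)).1 ^ 2) := by
        rw [hsum, boxQuad, Finset.mul_sum, ← add_assoc, ← Finset.sum_add_distrib]
        congr 1
        refine Finset.sum_congr rfl fun i _ => ?_
        ring

/-! ### The normaliser -/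

/-- The one-site Boltzmann weight `e^{-(p²/2 + ω₂ q²/2)}` is Lebesgue integrable (`ω₂ > 0`). [folklore] -/
theorem integrable_siteWeight_harmonic (hω : 0 < ω₂) (γ : ℝ) :
    Integrable fun z : ℝ × ℝ => Real.exp (-(1 : ℝ)⁻¹ * (z.2 ^ 2 / 2 + (pinnedChain ω₂ 0 0 γ).U z.1)) :=
  (pinnedChain ω₂ 0 0 γ).integrable_siteWeight one_pos (OscillatorChain.integrable_exp_neg_pinning one_pos hω le_rfl 0 γ)

/-- **`Z_Λ(η) ≤ z₀^{n+1}`**: the normaliser of the box is at most the `(n+1)`-st power of the one-site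
partition function (the interaction is non-negative). [folklore] -/
theorem boxZ_le_pow (γ : ℝ) (η : ChainConfig) :
    (∫⋯∫⁻_Finset.Icc a (a + n), (fun σ => ENNReal.ofReal (Real.exp (-(1 : ℝ)⁻¹ *
        hamiltonianIn (pinnedChain ω₂ 0 0 γ).chainPotential OscillatorChain.chainSupp (Finset.Icc a (a + n)) σ)))
      ∂fun _ : ℤ => (volume : Measure (ℝ × ℝ))) η ≤
      (∫⁻ z : ℝ × ℝ, ENNReal.ofReal (Real.exp (-(1 : ℝ)⁻¹ * (z.2 ^ 2 / 2 + (pinnedChain ω₂ 0 0 γ).U z.1)))) ^ (n + 1) := by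
  set P := pinnedChain ω₂ 0 0 γ with hP
  have hV0 : ∀ r, 0 ≤ P.V r := fun r => by rw [hP, pinnedChain_V_harmonic]; positivity
  have hφm : Measurable fun z : ℝ × ℝ => ENNReal.ofReal (Real.exp (-(1 : ℝ)⁻¹ * (z.2 ^ 2 / 2 + P.U z.1))) := by
    have : Continuous P.U := by
      rw [hP]; show Continuous fun q : ℝ => ω₂ * q ^ 2 / 2 + 0 * q ^ 4 / 4; fun_prop
    fun_prop
  calc _ ≤ (∫⋯∫⁻_Finset.Icc a (a + n), (fun σ : ChainConfig => ∏ y ∈ Finset.Icc a (a + n),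
          ENNReal.ofReal (Real.exp (-(1 : ℝ)⁻¹ * ((σ y).2 ^ 2 / 2 + P.U (σ y).1))))
          ∂fun _ : ℤ => (volume : Measure (ℝ × ℝ))) η :=
        (lmarginal_mono (fun σ => P.boltzmannWeight_le_prod one_pos hV0 (Finset.Icc a (a + n)) σ)) η
    _ = _ := by
        rw [OscillatorChain.lmarginal_prod_eq_pow hφm, card_Icc_box]

/-- The one-site partition function is finite. [folklore] -/
theorem siteZ_lt_top (hω : 0 < ω₂) (γ : ℝ) :
    (∫⁻ z : ℝ × ℝ, ENNReal.ofReal (Real.exp (-(1 : ℝ)⁻¹ * (z.2 ^ 2 / 2 + (pinnedChain ω₂ 0 0 γ).U z.1)))) < ∞ := by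
  have h := (integrable_siteWeight_harmonic ω₂ hω γ).2
  simpa only [HasFiniteIntegral, ← ofReal_norm, Real.norm_eq_abs, abs_of_pos (Real.exp_pos _)] using h

/-- The normaliser of the box is finite. [folklore] -/
theorem boxZ_lt_top (hω : 0 < ω₂) (γ : ℝ) (η : ChainConfig) :
    (∫⋯∫⁻_Finset.Icc a (a + n), (fun σ => ENNReal.ofReal (Real.exp (-(1 : ℝ)⁻¹ *
        hamiltonianIn (pinnedChain ω₂ 0 0 γ).chainPotential OscillatorChain.chainSupp (Finset.Icc a (a + n)) σ)))
      ∂fun _ : ℤ => (volume : Measure (ℝ × ℝ))) η < ∞ := by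
  have hV0 : ∀ r, 0 ≤ (pinnedChain ω₂ 0 0 γ).V r := fun r => by rw [pinnedChain_V_harmonic]; positivity
  exact (pinnedChain ω₂ 0 0 γ).lmarginal_boltzmann_lt_top one_pos hV0
    (OscillatorChain.integrable_exp_neg_pinning one_pos hω le_rfl 0 γ) _ η

/-- The normaliser of the box is positive. [folklore] -/
theorem boxZ_pos (γ : ℝ) (η : ChainConfig) :
    0 < (∫⋯∫⁻_Finset.Icc a (a + n), (fun σ => ENNReal.ofReal (Real.exp (-(1 : ℝ)⁻¹ *
        hamiltonianIn (pinnedChain ω₂ 0 0 γ).chainPotential OscillatorChain.chainSupp (Finset.Icc a (a + n)) σ)))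
      ∂fun _ : ℤ => (volume : Measure (ℝ × ℝ))) η := by
  refine (pinnedChain ω₂ 0 0 γ).lmarginal_boltzmann_pos ?_ ?_ 1 _ η
  · show Measurable fun q : ℝ => ω₂ * q ^ 2 / 2 + 0 * q ^ 4 / 4; fun_prop
  · show Measurable fun r : ℝ => r ^ 2 / 2 + 0 * r ^ 4 / 4; fun_prop

/-! ### Finite-volume expectations of box observables -/

/-- Measurability of the pinning potential of the harmonic chain. [folklore] -/
theorem measurable_U_harmonic (γ : ℝ) : Measurable (pinnedChain ω₂ 0 0 γ).U := by
  show Measurable fun q : ℝ => ω₂ * q ^ 2 / 2 + 0 * q ^ 4 / 4; fun_prop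

/-- Measurability of the interaction potential of the harmonic chain. [folklore] -/
theorem measurable_V_harmonic (γ : ℝ) : Measurable (pinnedChain ω₂ 0 0 γ).V := by
  show Measurable fun r : ℝ => r ^ 2 / 2 + 0 * r ^ 4 / 4; fun_prop

/-- **The finite-volume expectation of `e^{ψ ∘ box}`** under `γ_Λ(· | η)` of the harmonic chain
(`T = 1`) as a ratio of Lebesgue integrals over box data:
`∫ e^{ψ(box σ)} γ_Λ(dσ|η) = (∫⁻ e^{ψ x} e^{-H_Λ(x|η)} dx / ∫⁻ e^{-H_Λ(x|η)} dx).toReal`. [folklore] -/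
theorem integral_chainSpecification_exp_comp_box (hω : 0 < ω₂) (γ : ℝ) (η : ChainConfig)
    {ψ : (Fin (n + 1) → ℝ × ℝ) → ℝ} (hψ : Measurable ψ) :
    ∫ σ, Real.exp (ψ (boxRestrictAt a n σ)) ∂((pinnedChain ω₂ 0 0 γ).chainSpecification 1 (Finset.Icc a (a + n)) η) =
      ((∫⁻ x : Fin (n + 1) → ℝ × ℝ, ENNReal.ofReal (Real.exp (ψ x) * Real.exp (-(1 : ℝ)⁻¹ *
          hamiltonianIn (pinnedChain ω₂ 0 0 γ).chainPotential OscillatorChain.chainSupp (Finset.Icc a (a + n))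
            (insBox a n η x)))) /
        ∫⁻ x : Fin (n + 1) → ℝ × ℝ, ENNReal.ofReal (Real.exp (-(1 : ℝ)⁻¹ *
          hamiltonianIn (pinnedChain ω₂ 0 0 γ).chainPotential OscillatorChain.chainSupp (Finset.Icc a (a + n))
            (insBox a n η x)))).toReal := by
  set P := pinnedChain ω₂ 0 0 γ with hP
  set Λ := Finset.Icc a (a + n) with hΛ
  have hΨm : Measurable fun σ : ChainConfig => Real.exp (ψ (boxRestrictAt a n σ)) :=
    Real.measurable_exp.comp (hψ.comp (boxRestrictAt_measurable a n))
  have hFm : Measurable fun σ : ChainConfig => ENNReal.ofReal (Real.exp (ψ (boxRestrictAt a n σ))) :=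
    ENNReal.measurable_ofReal.comp hΨm
  -- the Bochner integral of the non-negative `Ψ` is the `toReal` of its lintegral
  rw [integral_eq_lintegral_of_nonneg_ae (Eventually.of_forall fun σ => (Real.exp_pos _).le)
    hΨm.aestronglyMeasurable]
  rw [P.lintegral_chainSpecification_eq_lmarginal_div (measurable_U_harmonic ω₂ γ) (measurable_V_harmonic ω₂ γ) 1 Λ η
    (boxZ_lt_top ω₂ a n hω γ η).ne hFm]
  rw [hΛ, lmarginal_Icc_eq_lintegral_insBox, lmarginal_Icc_eq_lintegral_insBox]
  congr 2
  refine lintegral_congr fun x => ?_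
  rw [boxRestrictAt_insBox, ← ENNReal.ofReal_mul (Real.exp_pos _).le]

/-- **The DLR equation for bounded observables** of the harmonic pinned chain at `T = 1`. [folklore] -/
theorem integral_eq_integral_chainSpecification_pinnedChain (hω : 0 < ω₂) (γ : ℝ) {μ : Measure ChainConfig}
    (hμ : (pinnedChain ω₂ 0 0 γ).IsChainGibbsMeasure 1 μ) (Λ : Finset ℤ) {Φ : ChainConfig → ℝ}
    (hΦ : Integrable Φ μ) :
    ∫ σ, Φ σ ∂μ = ∫ η, ∫ σ, Φ σ ∂((pinnedChain ω₂ 0 0 γ).chainSpecification 1 Λ η) ∂μ :=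
  integral_eq_integral_integral_chainSpecification (measurable_U_harmonic ω₂ γ) (measurable_V_harmonic ω₂ γ)
    (OscillatorChain.condB2_pinnedChain γ hω le_rfl le_rfl one_pos) hμ Λ hΦ

/-! ### A shift-invariant Gibbs state with controlled boundary values -/

/-- **A shift-invariant Gibbs state of the harmonic pinned chain at `T = 1` with boundary control**:
there are a translation-invariant DLR state `μ` and a radius `R` such that for all sites `x, y`,
`μ{|q_x| ≤ R ∧ |q_y| ≤ R} ≥ 1/2` (Chebyshev on the site-uniform second moments). [folklore] -/
theorem exists_gibbs_boundary_control (hω : 0 < ω₂) (γ : ℝ) :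
    ∃ (μ : Measure ChainConfig) (R : ℝ), (pinnedChain ω₂ 0 0 γ).IsChainGibbsMeasure 1 μ ∧ IsShiftInvariant μ ∧
      IsProbabilityMeasure μ ∧ 0 ≤ R ∧
      ∀ x y : ℤ, (1 / 2 : ℝ) ≤ μ.real {σ : ChainConfig | |(σ x).1| ≤ R ∧ |(σ y).1| ≤ R} := by
  obtain ⟨μ, hG, hS, -⟩ :=
    OscillatorChain.exists_isChainGibbsMeasure_shiftInvariant_superstable_pinnedChain γ hω le_rfl le_rfl one_pos
  haveI : IsProbabilityMeasure μ := hG.isProbabilityMeasure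
  obtain ⟨C, hC⟩ := OscillatorChain.exists_integral_abs_pow_add_le_pinnedChain_of_isShiftInvariant γ hω le_rfl le_rfl
    one_pos hG hS 2
  have hC0 : 0 ≤ C := le_trans (integral_nonneg fun σ => by positivity) (hC 0).2
  set R : ℝ := Real.sqrt (4 * C + 4) with hR
  have hRpos : 0 < R := Real.sqrt_pos.2 (by positivity)
  have hR2 : R ^ 2 = 4 * C + 4 := Real.sq_sqrt (by positivity)
  -- Chebyshev: `μ{R < |q_x|} ≤ C / R² ≤ 1/4`
  have hcheb : ∀ x : ℤ, μ.real {σ : ChainConfig | R < |(σ x).1|} ≤ 1 / 4 := by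
    intro x
    have hint : Integrable (fun σ : ChainConfig => |(σ x).1| ^ 2) μ :=
      OscillatorChain.integrable_abs_pow_of_add (hC x).1 |>.1
    have hmeas : MeasurableSet {σ : ChainConfig | R < |(σ x).1|} :=
      measurableSet_lt measurable_const ((measurable_pi_apply x).fst.abs)
    have h1 : R ^ 2 * μ.real {σ : ChainConfig | R < |(σ x).1|} ≤ ∫ σ, |(σ x).1| ^ 2 ∂μ := by
      have hind : ∫ σ, {σ : ChainConfig | R < |(σ x).1|}.indicator (fun _ => R ^ 2) σ ∂μ ≤ ∫ σ, |(σ x).1| ^ 2 ∂μ := by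
        refine integral_mono_of_nonneg (Eventually.of_forall fun σ => ?_) hint (Eventually.of_forall fun σ => ?_)
        · exact Set.indicator_nonneg (fun _ _ => by positivity) _
        · by_cases hσ : σ ∈ {σ : ChainConfig | R < |(σ x).1|}
          · rw [Set.indicator_of_mem hσ]
            have : R < |(σ x).1| := hσ
            nlinarith [abs_nonneg ((σ x).1), sq_abs ((σ x).1)]
          · rw [Set.indicator_of_notMem hσ]; positivity
      rwa [integral_indicator_const _ hmeas, smul_eq_mul, mul_comm] at hind
    have h2 : ∫ σ, |(σ x).1| ^ 2 ∂μ ≤ C :=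
      le_trans (integral_mono_of_nonneg (Eventually.of_forall fun σ => by positivity) (hC x).1
        (Eventually.of_forall fun σ => le_add_of_nonneg_right (by positivity))) (hC x).2
    have h3 : R ^ 2 * μ.real {σ : ChainConfig | R < |(σ x).1|} ≤ C := h1.trans h2
    rw [hR2] at h3
    have h4 : 0 ≤ μ.real {σ : ChainConfig | R < |(σ x).1|} := measureReal_nonneg
    nlinarith
  refine ⟨μ, R, hG, hS, inferInstance, hRpos.le, fun x y => ?_⟩
  -- complement and union bound
  have hsub : {σ : ChainConfig | |(σ x).1| ≤ R ∧ |(σ y).1| ≤ R}ᶜ ⊆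
      {σ : ChainConfig | R < |(σ x).1|} ∪ {σ : ChainConfig | R < |(σ y).1|} := by
    intro σ hσ
    simp only [Set.mem_compl_iff, Set.mem_setOf_eq, not_and_or, not_le] at hσ
    rcases hσ with h | h
    · exact Or.inl h
    · exact Or.inr h
  have hqx : Measurable fun σ : ChainConfig => |(σ x).1| := (measurable_pi_apply x).fst.abs
  have hqy : Measurable fun σ : ChainConfig => |(σ y).1| := (measurable_pi_apply y).fst.abs
  have hmeas : MeasurableSet {σ : ChainConfig | |(σ x).1| ≤ R ∧ |(σ y).1| ≤ R} := by
    rw [Set.setOf_and]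
    exact (measurableSet_le hqx measurable_const).inter (measurableSet_le hqy measurable_const)
  have hc : μ.real {σ : ChainConfig | |(σ x).1| ≤ R ∧ |(σ y).1| ≤ R}ᶜ ≤ 1 / 2 := by
    calc μ.real {σ : ChainConfig | |(σ x).1| ≤ R ∧ |(σ y).1| ≤ R}ᶜ
        ≤ μ.real ({σ : ChainConfig | R < |(σ x).1|} ∪ {σ : ChainConfig | R < |(σ y).1|}) :=
          measureReal_mono hsub
      _ ≤ μ.real {σ : ChainConfig | R < |(σ x).1|} + μ.real {σ : ChainConfig | R < |(σ y).1|} :=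
          measureReal_union_le _ _
      _ ≤ 1 / 4 + 1 / 4 := add_le_add (hcheb x) (hcheb y)
      _ = 1 / 2 := by norm_num
  have htot : μ.real {σ : ChainConfig | |(σ x).1| ≤ R ∧ |(σ y).1| ≤ R} +
      μ.real {σ : ChainConfig | |(σ x).1| ≤ R ∧ |(σ y).1| ≤ R}ᶜ = 1 := by
    rw [measureReal_add_measureReal_compl hmeas, probReal_univ]
  linarith

end Summit.AtomisticToContinuum.FouriersLaw.Theorems.ParityLiouvilleSeed.HarmonicWitness

end
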